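import Mathlib
import HarnessLib
import Summits.CriticalPhenomena.CardyFormulaZ2.Theorems.CardyMagicRigidityMagicFormulaTCoefficientExchange
import Summits.CriticalPhenomena.CardyFormulaZ2.Theorems.CardyMagicRigidityMagicFormulaTCoefficientFormulas
import Literature.Probability.Percolation.SiteNestingWeightBound

/-!
# Line `Sketch` (v9) for crux `MagicFormulaT`, sub-goal HO `ho_thirdOrder_of_threePoint`:
# the order-3 coefficient identification reduces to the three-point power-sum limit

Crux `Summit.CriticalPhenomena.CardyFormulaZ2.Theses.CardyMagicRigidity.MagicFormulaT`
(stmt-CriticalPhenomena-4836), line `Sketch`, skeleton v8.1 → v9, wave-3 sub-goal HO.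

For an admissible density `f` (`|f| ≤ C`, `f = 0` off `B̄(0, R)`, `∫ f = 0`) put `θ_u = u.nestingPhase f`,
`A_m = Σ_u θ_u^m` (loops of `siteLoopConfig δ ω`), `Φ_δ(t) = E_{1/2}[∏_u 2cos(t θ_u + π/3)]` and
`G_f(t) = exp(q(f) t²)`, `q(f) = (3/4π²) ∬ log‖x − y‖ f(x) f(y)`.  **Claim.**  If
`E_{1/2}[3A₁³ − 12A₁A₂ + 8A₃] → 0` as `δ ↓ 0`, then every limit `a` of `Φ_δ'''(0)` along `δ ↓ 0` equals
`G_f'''(0)`.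

Proof.  (1) At fixed mesh `δ > 0`, `Φ_δ'''(0) = E[∂_t³ ∏_u 2cos(t θ_u + π/3) |_{t=0}]`
(`cf_iteratedDeriv_eq_integral`) `= E[√3(−3A₁³ + 12A₁A₂ − 8A₃)]` (`cf_iteratedDeriv_three_finprod`, the
finiteness of the loops meeting `B̄(0, R)` being `ncard_loops_siteLoopConfig_meeting_le`)
`= −√3 · E[3A₁³ − 12A₁A₂ + 8A₃]` (`integral_complex_ofReal`, `integral_const_mul`).  (2) Hence along
`𝓝[>] 0` the coefficient tends to `−√3 · 0 = 0`, so `a = 0` by uniqueness of limits.  (3) `G_f'''(0) = 0`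
since `G_f` is even: `iteratedDeriv_comp_neg` gives `G_f'''(0) = (−1)³ G_f'''(0)`.
No named fact is used; no definition is introduced.
-/

noncomputable section

namespace Summit.CriticalPhenomena.CardyFormulaZ2.Cruxes.MagicFormulaT.LineSketch

open MeasureTheory Filter Set
open scoped Real Topology BigOperators ENNReal
open Literature.Probability.RandomPlanarGeometry Literature.Probability.Percolation
  Literature.Probability.LatticeModels

/-- **The third derivative at `0` of the even Gaussian `t ↦ exp(c t²)` vanishes**: by
`iteratedDeriv_comp_neg`, `G'''(0) = (−1)³ G'''(0)` for the even function `G`. -/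
theorem ho_iteratedDeriv_three_cexp_sq (c : ℂ) :
    iteratedDeriv 3 (fun t : ℂ ↦ Complex.exp (c * t ^ 2)) 0 = 0 := by
  set G : ℂ → ℂ := fun t ↦ Complex.exp (c * t ^ 2) with hG
  have heven : (fun t ↦ G (-t)) = G := funext fun t ↦ by simp only [hG, neg_sq]
  have h1 := iteratedDeriv_comp_neg 3 G 0
  rw [heven, neg_zero] at h1
  have h2 : iteratedDeriv 3 G 0 = -iteratedDeriv 3 G 0 := by
    calc iteratedDeriv 3 G 0 = (-1 : ℂ) ^ 3 • iteratedDeriv 3 G 0 := h1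
      _ = -iteratedDeriv 3 G 0 := by rw [smul_eq_mul]; ring
  exact CharZero.eq_neg_self_iff.1 h2

/-- **The order-3 Taylor coefficient at fixed mesh.**  For admissible `f` and `δ > 0`,
`Φ_δ'''(0) = −√3 · E_{1/2}[3A₁³ − 12A₁A₂ + 8A₃]`: exchange derivative and expectation
(`cf_iteratedDeriv_eq_integral`), evaluate the pathwise third derivative (`cf_iteratedDeriv_three_finprod`,
finitely many loops meet the ball by `ncard_loops_siteLoopConfig_meeting_le`), and pull the real scalar out. -/
theorem ho_iteratedDeriv_three_eq {f : ℂ → ℝ} {R C : ℝ} (hf : Measurable f) (hC : ∀ z, |f z| ≤ C)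
    (hR : ∀ z, R < ‖z‖ → f z = 0) (h0 : ∫ z, f z = 0) {δ : ℝ} (hδ : 0 < δ) :
    iteratedDeriv 3 (fun t : ℂ ↦ ∫ ω, (∏ᶠ u ∈ (siteLoopConfig δ ω).loops,
      2 * Complex.cos (t * ((u.nestingPhase f : ℝ) : ℂ) + (Real.pi : ℂ) / 3)) ∂(triSitePercolation half)) 0 =
    ((-Real.sqrt 3 * ∫ ω, (3 * (∑ᶠ u ∈ (siteLoopConfig δ ω).loops, u.nestingPhase f) ^ 3 -
      12 * (∑ᶠ u ∈ (siteLoopConfig δ ω).loops, u.nestingPhase f) *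
        (∑ᶠ u ∈ (siteLoopConfig δ ω).loops, u.nestingPhase f ^ 2) +
      8 * (∑ᶠ u ∈ (siteLoopConfig δ ω).loops, u.nestingPhase f ^ 3)) ∂(triSitePercolation half) : ℝ) :
      ℂ) := by
  rw [cf_iteratedDeriv_eq_integral f R C hf hC hR h0 δ hδ 3 0]
  have hpt : ∀ ω, iteratedDeriv 3 (fun t : ℂ ↦ ∏ᶠ u ∈ (siteLoopConfig δ ω).loops,
      2 * Complex.cos (t * ((u.nestingPhase f : ℝ) : ℂ) + (Real.pi : ℂ) / 3)) 0 =
      ((-Real.sqrt 3 * (3 * (∑ᶠ u ∈ (siteLoopConfig δ ω).loops, u.nestingPhase f) ^ 3 -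
        12 * (∑ᶠ u ∈ (siteLoopConfig δ ω).loops, u.nestingPhase f) *
          (∑ᶠ u ∈ (siteLoopConfig δ ω).loops, u.nestingPhase f ^ 2) +
        8 * (∑ᶠ u ∈ (siteLoopConfig δ ω).loops, u.nestingPhase f ^ 3)) : ℝ) : ℂ) := fun ω ↦ by
    rw [cf_iteratedDeriv_three_finprod f R hR h0 _ (ncard_loops_siteLoopConfig_meeting_le hδ R ω).1]
    push_cast
    ring
  simp_rw [hpt]
  rw [integral_complex_ofReal, integral_const_mul]

/-- **Sub-goal HO (`ho_thirdOrder_of_threePoint`) · order 3 of the coefficient identification follows from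
the three-point power-sum limit.**  If `E_{1/2}[3A₁³ − 12A₁A₂ + 8A₃] → 0` as the mesh `δ ↓ 0`
(`A_m = Σ_u θ_u(f)^m`), then any limit `a` of the third Taylor coefficients `Φ_δ'''(0)` of the complex-coupling
nesting transforms equals `G_f'''(0)` for `G_f(t) = exp(q(f) t²)`; indeed both vanish:
`Φ_δ'''(0) = −√3 E[3A₁³ − 12A₁A₂ + 8A₃] → 0` (`ho_iteratedDeriv_three_eq`, uniqueness of limits along the
non-trivial filter `𝓝[>] 0`), and `G_f'''(0) = 0` by evenness (`ho_iteratedDeriv_three_cexp_sq`). -/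
theorem ho_thirdOrder_of_threePoint : ∀ (f : ℂ → ℝ) (R C : ℝ), Measurable f → (∀ z, |f z| ≤ C) →
    (∀ z, R < ‖z‖ → f z = 0) → ∫ z, f z = 0 →
    Tendsto (fun δ : ℝ ↦ ∫ ω, (3 * (∑ᶠ u ∈ (siteLoopConfig δ ω).loops, u.nestingPhase f) ^ 3 -
      12 * (∑ᶠ u ∈ (siteLoopConfig δ ω).loops, u.nestingPhase f) *
        (∑ᶠ u ∈ (siteLoopConfig δ ω).loops, u.nestingPhase f ^ 2) +
      8 * (∑ᶠ u ∈ (siteLoopConfig δ ω).loops, u.nestingPhase f ^ 3)) ∂(triSitePercolation half))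
      (𝓝[>] (0 : ℝ)) (𝓝 0) →
    ∀ a : ℂ, Tendsto (fun δ : ℝ ↦ iteratedDeriv 3 (fun t : ℂ ↦ ∫ ω, (∏ᶠ u ∈ (siteLoopConfig δ ω).loops,
      2 * Complex.cos (t * ((u.nestingPhase f : ℝ) : ℂ) + (Real.pi : ℂ) / 3)) ∂(triSitePercolation half)) 0)
      (𝓝[>] (0 : ℝ)) (𝓝 a) →
    a = iteratedDeriv 3 (fun t : ℂ ↦ Complex.exp
      (((3 / (4 * π ^ 2) * ∫ x, ∫ y, Real.log ‖x - y‖ * f x * f y : ℝ) : ℂ) * t ^ 2)) 0 := by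
  intro f R C hf hC hR h0 hlim a ha
  rw [ho_iteratedDeriv_three_cexp_sq]
  -- the coefficient, rewritten at every positive mesh, tends to `↑(−√3 · 0) = 0`
  have hev : ∀ᶠ δ in 𝓝[>] (0 : ℝ),
      ((-Real.sqrt 3 * ∫ ω, (3 * (∑ᶠ u ∈ (siteLoopConfig δ ω).loops, u.nestingPhase f) ^ 3 -
        12 * (∑ᶠ u ∈ (siteLoopConfig δ ω).loops, u.nestingPhase f) *
          (∑ᶠ u ∈ (siteLoopConfig δ ω).loops, u.nestingPhase f ^ 2) +
        8 * (∑ᶠ u ∈ (siteLoopConfig δ ω).loops, u.nestingPhase f ^ 3)) ∂(triSitePercolation half) : ℝ) :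
        ℂ) =
      iteratedDeriv 3 (fun t : ℂ ↦ ∫ ω, (∏ᶠ u ∈ (siteLoopConfig δ ω).loops,
        2 * Complex.cos (t * ((u.nestingPhase f : ℝ) : ℂ) + (Real.pi : ℂ) / 3)) ∂(triSitePercolation half)) 0 :=
    eventually_nhdsWithin_of_forall fun δ hδ ↦ (ho_iteratedDeriv_three_eq hf hC hR h0 hδ).symm
  have h2 := ((Complex.continuous_ofReal.tendsto _).comp (hlim.const_mul (-Real.sqrt 3))).congr' hev
  rw [mul_zero, Complex.ofReal_zero] at h2
  exact tendsto_nhds_unique ha h2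

end Summit.CriticalPhenomena.CardyFormulaZ2.Cruxes.MagicFormulaT.LineSketch

end
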